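import Literature.Barriers.RiemannHypothesis.EpsteinZetaChowlaSelbergLines
import HarnessLib

/-!
# Baker's limit formula, I: a twisted Epstein zeta function as a sum over lattice lines

Topic `NumberTheory/QuadraticFields`, namespace `Literature.NumberTheory.QuadraticFields.BakerLimitFormula`.
Everything here is PROVED (two definitions — the twisted term and the twisted sum — and theorems).

This is the first analytic file towards the limit formula of A. Baker, *Transcendental Number
Theory* (1975), Ch. 5 §§2–3 (held copy, PDF pp. 48–50): for a positive definite form
`f = ax² + bxy + cy²` and a weight `w(x, y)` which is `k`-periodic in `x` (in the source
`w = χ(f(x, y))` for a real character `χ` modulo `k`),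
"the second term can be expanded as a Fourier series" — obtained there by Poisson summation in `x`
along each line `y ≥ 1` after "writing `x = m + kyn`". We organise the same computation through the
`K`-Bessel expansion of a lattice line already proved in the tree
(`Literature.Barriers.RiemannHypothesis.tsum_sq_add_sq_cpow_neg_eq`, Rankin / Bateman–Grosswald):
for `Re s > 1`,

* `twistZeta w a b c s = Σ'_{(x,y)} w(x,y) f(x,y)^{−s}` converges absolutely for bounded `w`
  (`summable_norm_twistTerm`) and is the sum of its lines (`twistZeta_eq_tsum_lines`), which are
  even in `y` for centrally symmetric `w` (`tsum_twistLine_neg`), so that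
  `twistZeta = line₀ + 2 Σ_{y≥1} line_y` (`twistZeta_eq_line_zero_add`);
* splitting a line `y ≠ 0` into residue classes `x = j + kn` (`tsum_twistLine_eq_sum_tsum`), and
* the expansion of each class (`tsum_epsteinTerm_residueClass`):
  `Σ_n f(j + kn, y)^{−s} = a^{−s} k^{−2s} [ Y^{1−2s} π^{½} Γ(s−½)/Γ(s)
      + (4π^s/Γ(s)) Y^{½−s} Σ_{r≥1} r^{s−½} cos(2πr α) K_{s−½}(2πr Y) ]`,
  `Y = κy/k`, `α = (j + yβ)/k`, `β = b/(2a)`, `κ = √(4ac − b²)/(2a)` (`starkK`),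
  i.e. Baker's `A_r(s)`-expansion with `g = a(x + vy)² + (d/4a)y²`.

## References

* [Baker1975] A. Baker, *Transcendental Number Theory* (1975), Ch. 5 §2 (pp. 48–49).
* [BatemanGrosswald1964] P. T. Bateman, E. Grosswald, *On Epstein's zeta function*, Acta Arith. 9
  (1964), proof of Theorem 1 (the line expansion).
-/

noncomputable section

open Filter Topology Real Complex
open Literature.Barriers.RiemannHypothesis Literature.Analysis.FunctionSpaces

namespace Literature.NumberTheory.QuadraticFields.BakerLimitFormula

variable {a b c : ℝ}

/-! ## The twisted Epstein zeta function -/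

/-- The general term `w(x, y) f(x, y)^{−s}` of the twisted Epstein series (`0` at the origin).
[cite: Baker1975, Ch. 5 §2 eq. (1)] -/
def twistTerm (w : ℤ × ℤ → ℂ) (a b c : ℝ) (s : ℂ) (p : ℤ × ℤ) : ℂ :=
  w p * epsteinTerm a b c s p

/-- The twisted Epstein zeta function `Σ'_{(x,y)} w(x, y) f(x, y)^{−s}` as a `tsum` over `ℤ × ℤ`
(absolutely convergent for `Re s > 1` and bounded `w`). [cite: Baker1975, Ch. 5 §2 eq. (1)] -/
def twistZeta (w : ℤ × ℤ → ℂ) (a b c : ℝ) (s : ℂ) : ℂ :=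
  ∑' p : ℤ × ℤ, twistTerm w a b c s p

/-- Absolute convergence for `Re s > 1` and `|w| ≤ C`. [folklore] -/
theorem summable_norm_twistTerm (h : IsPosDefForm a b c) {w : ℤ × ℤ → ℂ} {C : ℝ}
    (hw : ∀ p, ‖w p‖ ≤ C) {s : ℂ} (hs : 1 < s.re) :
    Summable fun p : ℤ × ℤ => ‖twistTerm w a b c s p‖ := by
  have hC : 0 ≤ C := (norm_nonneg _).trans (hw 0)
  refine ((summable_norm_epsteinTerm h hs).mul_left C).of_nonneg_of_le (fun p => norm_nonneg _)
    fun p => ?_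
  rw [twistTerm, norm_mul]
  exact mul_le_mul_of_nonneg_right (hw p) (norm_nonneg _)

/-- The twisted series is summable, so `twistZeta` is its sum. [folklore] -/
theorem hasSum_twistZeta (h : IsPosDefForm a b c) {w : ℤ × ℤ → ℂ} {C : ℝ} (hw : ∀ p, ‖w p‖ ≤ C)
    {s : ℂ} (hs : 1 < s.re) : HasSum (twistTerm w a b c s) (twistZeta w a b c s) :=
  (summable_norm_twistTerm h hw hs).of_norm.hasSum

/-- **Sum over lines**: `Σ' w f^{−s} = Σ_{y∈ℤ} Σ_{x∈ℤ} w(x,y) f(x,y)^{−s}`, the outer series and every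
line being summable. [cite: Baker1975, Ch. 5 §2] -/
theorem twistZeta_eq_tsum_lines (h : IsPosDefForm a b c) {w : ℤ × ℤ → ℂ} {C : ℝ}
    (hw : ∀ p, ‖w p‖ ≤ C) {s : ℂ} (hs : 1 < s.re) :
    twistZeta w a b c s = ∑' y : ℤ, ∑' x : ℤ, twistTerm w a b c s (x, y) ∧
      (Summable fun y : ℤ => ∑' x : ℤ, twistTerm w a b c s (x, y)) ∧
      ∀ y : ℤ, Summable fun x : ℤ => twistTerm w a b c s (x, y) := by
  have hS : Summable (twistTerm w a b c s) := (summable_norm_twistTerm h hw hs).of_norm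
  have hT : Summable fun p : ℤ × ℤ => twistTerm w a b c s (p.2, p.1) := by
    have := hS.comp_injective (Equiv.prodComm ℤ ℤ).injective
    simpa [Function.comp_def, Prod.swap] using this
  refine ⟨?_, hT.prod, fun y => hT.prod_factor y⟩
  unfold twistZeta
  rw [← (Equiv.prodComm ℤ ℤ).tsum_eq (twistTerm w a b c s), ← hT.tsum_prod]
  exact tsum_congr fun p => by simp only [Equiv.prodComm_apply, Prod.swap]

/-- The lines are even in `y` when `w(−x, −y) = w(x, y)`. [folklore] -/
theorem tsum_twistLine_neg {w : ℤ × ℤ → ℂ} (hw : ∀ p, w (-p) = w p) (a b c : ℝ) (s : ℂ) (y : ℤ) :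
    ∑' x : ℤ, twistTerm w a b c s (x, -y) = ∑' x : ℤ, twistTerm w a b c s (x, y) := by
  rw [← (Equiv.neg ℤ).tsum_eq (fun x => twistTerm w a b c s (x, -y))]
  refine tsum_congr fun x => ?_
  simp only [Equiv.neg_apply, twistTerm]
  rw [epsteinTerm_neg_neg a b c s x y, show ((-x, -y) : ℤ × ℤ) = -(x, y) from rfl, hw]

/-- **`Σ' w f^{−s} = line₀ + 2 Σ_{y≥1} line_y`** for centrally symmetric `w` (`Re s > 1`), with the
series over `y ≥ 1` summable. [cite: Baker1975, Ch. 5 §2] -/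
theorem twistZeta_eq_line_zero_add (h : IsPosDefForm a b c) {w : ℤ × ℤ → ℂ} {C : ℝ}
    (hw : ∀ p, ‖w p‖ ≤ C) (hsym : ∀ p, w (-p) = w p) {s : ℂ} (hs : 1 < s.re) :
    twistZeta w a b c s = ∑' x : ℤ, twistTerm w a b c s (x, 0) +
        2 * ∑' y : ℕ, ∑' x : ℤ, twistTerm w a b c s (x, ((y + 1 : ℕ) : ℤ)) ∧
      Summable fun y : ℕ => ∑' x : ℤ, twistTerm w a b c s (x, ((y + 1 : ℕ) : ℤ)) := by
  obtain ⟨hZ, hf, -⟩ := twistZeta_eq_tsum_lines h hw hs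
  have heven : Function.Even fun y : ℤ => ∑' x : ℤ, twistTerm w a b c s (x, y) :=
    fun y => tsum_twistLine_neg hsym a b c s y
  have hsucc : Summable fun y : ℕ => ∑' x : ℤ, twistTerm w a b c s (x, ((y + 1 : ℕ) : ℤ)) :=
    (summable_nat_add_iff 1).2 (hf.comp_injective Nat.cast_injective)
  refine ⟨?_, hsucc⟩
  rw [hZ, tsum_int_eq_zero_add_two_mul_tsum_pnat heven hf, nsmul_eq_mul,
    tsum_pnat_eq_tsum_succ (f := fun y : ℕ => ∑' x : ℤ, twistTerm w a b c s (x, (y : ℤ)))]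
  push_cast
  ring_nf

/-! ## Splitting a line into residue classes modulo `k` -/

/-- **Residue classes**: if `w(x + k, y) = w(x, y)` for all `x`, then
`Σ_x w(x, y) f(x, y)^{−s} = Σ_{j<k} w(j, y) Σ_n f(j + kn, y)^{−s}` (Baker: "writing `x = m + kyn`";
we split modulo `k` only). [cite: Baker1975, Ch. 5 §2] -/
theorem tsum_twistLine_eq_sum_tsum {w : ℤ × ℤ → ℂ} {k : ℕ} [NeZero k] {y : ℤ}
    (hper : ∀ x, w (x + k, y) = w (x, y)) (s : ℂ)
    (hsum : Summable fun x : ℤ => twistTerm w a b c s (x, y)) :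
    ∑' x : ℤ, twistTerm w a b c s (x, y) =
      ∑ j : Fin k, w ((j : ℕ), y) * ∑' n : ℤ, epsteinTerm a b c s ((j : ℕ) + k * n, y) := by
  set e := Int.divModEquiv k with he
  -- periodicity: `w(j + kn, y) = w(j, y)`
  have hperiod : ∀ (n : ℤ) (j : ℤ), w (j + k * n, y) = w (j, y) := by
    intro n j
    induction n using Int.induction_on with
    | zero => rw [mul_zero, add_zero]
    | succ n ih => rw [mul_add, mul_one, ← add_assoc, hper, ih]
    | pred n ih =>
      have := hper (j + k * (-(n : ℤ) - 1))
      rw [show j + ↑k * (-(n : ℤ) - 1) + ↑k = j + ↑k * -(n : ℤ) by ring] at this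
      exact this.symm.trans ih
  have hS : Summable fun p : ℤ × Fin k => twistTerm w a b c s (e.symm p, y) :=
    (e.symm.summable_iff (f := fun x : ℤ => twistTerm w a b c s (x, y))).mpr hsum
  rw [← e.symm.tsum_eq, hS.tsum_prod]
  have hinner : ∀ n : ℤ, ∑' j : Fin k, twistTerm w a b c s (e.symm (n, j), y) =
      ∑ j : Fin k, w ((j : ℕ), y) * epsteinTerm a b c s ((j : ℕ) + k * n, y) := by
    intro n
    rw [tsum_fintype]
    refine Finset.sum_congr rfl fun j _ => ?_
    simp only [he, Int.divModEquiv_symm_apply, twistTerm]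
    rw [show n * (k : ℤ) + ((j : ℕ) : ℤ) = ((j : ℕ) : ℤ) + k * n by ring, hperiod]
  have hWj : ∀ j : Fin k, Summable fun n : ℤ => w ((j : ℕ), y) * epsteinTerm a b c s ((j : ℕ) + k * n, y) := by
    intro j
    have hk : (k : ℤ) ≠ 0 := by exact_mod_cast NeZero.ne k
    have h1 : Summable fun n : ℤ => twistTerm w a b c s (((j : ℕ) : ℤ) + k * n, y) :=
      hsum.comp_injective (fun n n' hh => by
        have hh' : ((j : ℕ) : ℤ) + k * n = ((j : ℕ) : ℤ) + k * n' := hh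
        exact mul_left_cancel₀ hk (add_left_cancel hh'))
    refine h1.congr fun n => ?_
    simp only [twistTerm]
    rw [hperiod]
  rw [tsum_congr hinner, Summable.tsum_finsetSum fun j _ => hWj j]
  exact Finset.sum_congr rfl fun j _ => tsum_mul_left

/-! ## The `K`-Bessel expansion of a residue class of a line -/

/-- The height `Y = κ y / k` of the residue-class line (`κ = √(4ac − b²)/(2a)`).
[cite: Baker1975, Ch. 5 §2] -/
def lineY (a b c : ℝ) (k : ℕ) (y : ℤ) : ℝ := starkK a b c * y / k

/-- The shift `α = (j + yβ)/k`, `β = b/(2a)`, of the residue-class line. [cite: Baker1975, Ch. 5 §2] -/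
def lineα (a b : ℝ) (k : ℕ) (j y : ℤ) : ℝ := ((j : ℝ) + (y : ℝ) * (b / (2 * a))) / k

/-- `Y > 0` for `y ≥ 1`. [folklore] -/
theorem lineY_pos (h : IsPosDefForm a b c) {k : ℕ} (hk : 0 < k) {y : ℤ} (hy : 0 < y) :
    0 < lineY a b c k y := by
  unfold lineY
  have := starkK_pos h
  have hy' : (0 : ℝ) < y := by exact_mod_cast hy
  have hk' : (0 : ℝ) < k := by exact_mod_cast hk
  positivity

/-- Completing the square on a residue class: `f(j + kn, y) = a k² ((n + α)² + Y²)`, in the form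
`f(j + kn, y)^{−s} = a^{−s} k^{−2s} ((n + α)² + Y²)^{−s}`. [cite: Baker1975, Ch. 5 §2] -/
theorem epsteinTerm_residueClass (h : IsPosDefForm a b c) (s : ℂ) {k : ℕ} (hk : 0 < k) (j : ℤ)
    {y : ℤ} (hy : 0 < y) (n : ℤ) :
    epsteinTerm a b c s (j + k * n, y) = (a : ℂ) ^ (-s) * ((k : ℂ) ^ (2 * -s) *
      (((((n : ℝ) + lineα a b k j y) ^ 2 + (lineY a b c k y) ^ 2 : ℝ)) : ℂ) ^ (-s)) := by
  have hkR : (0 : ℝ) < k := by exact_mod_cast hk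
  have ha := h.a_pos.ne'
  rw [epsteinTerm_eq_of_ne_zero h s hy.ne' (j + k * n)]
  congr 1
  have hquad : (((j + k * n : ℤ) : ℝ) + (y : ℝ) * (b / (2 * a))) ^ 2 + (starkK a b c * (y : ℝ)) ^ 2 =
      (k : ℝ) ^ 2 * ((((n : ℝ) + lineα a b k j y) ^ 2 + (lineY a b c k y) ^ 2)) := by
    unfold lineα lineY
    push_cast
    field_simp
    ring
  rw [hquad, Complex.ofReal_mul, Complex.mul_cpow_ofReal_nonneg (sq_nonneg _) (by positivity),
    ofReal_sq_cpow hkR, Complex.ofReal_natCast]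

/-- **The `K`-Bessel expansion of a residue class of a line** (`Re s > 1`, `y ≥ 1`, `k ≥ 1`):
`Σ_n f(j + kn, y)^{−s} = a^{−s} k^{−2s} [ Y^{1−2s} π^{½} Γ(s−½)/Γ(s)
   + (4π^s/Γ(s)) Y^{½−s} Σ_{r≥1} r^{s−½} cos(2πrα) K_{s−½}(2πrY) ]`, `Y = κy/k`, `α = (j + yβ)/k`
(the tree's `tsum_sq_add_sq_cpow_neg_eq`; in Baker's notation the terms `A_r(s)` of the Fourier
expansion of the second term). [cite: Baker1975, Ch. 5 §2] -/
theorem tsum_epsteinTerm_residueClass (h : IsPosDefForm a b c) {s : ℂ} (hs : 1 < s.re) {k : ℕ}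
    (hk : 0 < k) (j : ℤ) {y : ℤ} (hy : 0 < y) :
    ∑' n : ℤ, epsteinTerm a b c s (j + k * n, y) = (a : ℂ) ^ (-s) * (k : ℂ) ^ (2 * -s) *
      ((lineY a b c k y : ℂ) ^ (1 - 2 * s) * (π : ℂ) ^ (1 / 2 : ℂ) * Complex.Gamma (s - 1 / 2) /
          Complex.Gamma s +
        4 * (π : ℂ) ^ s / Complex.Gamma s * (lineY a b c k y : ℂ) ^ (1 / 2 - s) *
          ∑' r : ℕ, ((r + 1 : ℕ) : ℂ) ^ (s - 1 / 2) *
            (Real.cos (2 * π * ((r + 1 : ℕ) : ℝ) * lineα a b k j y) : ℂ) *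
            besselK (s - 1 / 2) ((2 * π * ((r + 1 : ℕ) : ℝ) * lineY a b c k y : ℝ) : ℂ)) := by
  have hs' : 1 / 2 < s.re := by linarith
  simp_rw [epsteinTerm_residueClass h s hk j hy]
  rw [tsum_mul_left, tsum_mul_left, tsum_sq_add_sq_cpow_neg_eq (lineY_pos h hk hy) (lineα a b k j y) hs']
  ring

/-! ## A line `y ≥ 1` = main part + Bessel part -/

/-- The character sum of a line: `c_y = Σ_{j<k} w(j, y)` (for `w = χ ∘ f` this is Baker's
`Σ_{j=1}^{k} χ(f(j, y))`). [cite: Baker1975, Ch. 5 §§2–3] -/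
def lineCharSum (w : ℤ × ℤ → ℂ) (k : ℕ) (y : ℤ) : ℂ := ∑ j : Fin k, w ((j : ℕ), y)

/-- **The main part of the line `y`**:
`a^{−s} k^{−2s} c_y · Y^{1−2s} π^{½} Γ(s−½)/Γ(s)` (Baker's `A_0(s)`-contribution of the line).
[cite: Baker1975, Ch. 5 §3] -/
def mainPart (w : ℤ × ℤ → ℂ) (a b c : ℝ) (k : ℕ) (s : ℂ) (y : ℤ) : ℂ :=
  (a : ℂ) ^ (-s) * (k : ℂ) ^ (2 * -s) * (lineCharSum w k y *
    ((lineY a b c k y : ℂ) ^ (1 - 2 * s) * (π : ℂ) ^ (1 / 2 : ℂ) * Complex.Gamma (s - 1 / 2) /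
      Complex.Gamma s))

/-- The inner Bessel series of the residue class `j` of the line `y`:
`Σ_{r≥1} r^{s−½} cos(2πrα_j) K_{s−½}(2πrY)`. [cite: Baker1975, Ch. 5 §3] -/
def besselSeries (a b c : ℝ) (k : ℕ) (s : ℂ) (j y : ℤ) : ℂ :=
  ∑' r : ℕ, ((r + 1 : ℕ) : ℂ) ^ (s - 1 / 2) *
    (Real.cos (2 * π * ((r + 1 : ℕ) : ℝ) * lineα a b k j y) : ℂ) *
    besselK (s - 1 / 2) ((2 * π * ((r + 1 : ℕ) : ℝ) * lineY a b c k y : ℝ) : ℂ)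

/-- **The Bessel part of the line `y`**:
`a^{−s} k^{−2s} (4π^s/Γ(s)) Y^{½−s} Σ_{j<k} w(j, y) Σ_{r≥1} r^{s−½} cos(2πrα_j) K_{s−½}(2πrY)`
(Baker's `Σ_{r≠0} A_r(s) e^{πirb/(ka)}`-contribution of the line). [cite: Baker1975, Ch. 5 §3] -/
def besselPart (w : ℤ × ℤ → ℂ) (a b c : ℝ) (k : ℕ) (s : ℂ) (y : ℤ) : ℂ :=
  (a : ℂ) ^ (-s) * (k : ℂ) ^ (2 * -s) * (4 * (π : ℂ) ^ s / Complex.Gamma s *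
    (lineY a b c k y : ℂ) ^ (1 / 2 - s) * ∑ j : Fin k, w ((j : ℕ), y) * besselSeries a b c k s ((j : ℕ)) y)

/-- **A line `y ≥ 1` of the twisted Epstein zeta function is its main part plus its Bessel part**
(`Re s > 1`, `w` `k`-periodic in `x`). [cite: Baker1975, Ch. 5 §§2–3] -/
theorem tsum_twistLine_eq_mainPart_add_besselPart (h : IsPosDefForm a b c) {w : ℤ × ℤ → ℂ} {C : ℝ}
    (hw : ∀ p, ‖w p‖ ≤ C) {k : ℕ} [NeZero k] {y : ℤ} (hy : 0 < y)
    (hper : ∀ x, w (x + k, y) = w (x, y)) {s : ℂ} (hs : 1 < s.re) :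
    ∑' x : ℤ, twistTerm w a b c s (x, y) = mainPart w a b c k s y + besselPart w a b c k s y := by
  have hk : 0 < k := Nat.pos_of_ne_zero (NeZero.ne k)
  obtain ⟨-, -, hline⟩ := twistZeta_eq_tsum_lines h hw hs
  rw [tsum_twistLine_eq_sum_tsum hper s (hline y)]
  simp_rw [tsum_epsteinTerm_residueClass h hs hk _ hy]
  unfold mainPart besselPart lineCharSum besselSeries
  simp only [Finset.mul_sum, Finset.sum_mul, ← Finset.sum_add_distrib]
  refine Finset.sum_congr rfl fun j _ => ?_
  ring

end Literature.NumberTheory.QuadraticFields.BakerLimitFormula
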